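import Mathlib.Algebra.DirectSum.Module
import Summits.Ventures.HodgeRepro2.HostAPI.Carriers.NumberTheory.Transcendental.Analytification
import Summits.Ventures.HodgeRepro2.HostAPI.Carriers.NumberTheory.Transcendental.DeRhamTheorem
import Summits.Ventures.HodgeRepro2.HostAPI.Util.ForallBinderLint
open HostAPI.Carriers

noncomputable section

open scoped Manifold ContDiff
open CategoryTheory

universe u

namespace HostAPI.Carriers.AlgebraicGeometry.HodgeTheory

section HodgeTheory

def IsRationalClass {Y : Type u} [TopologicalSpace Y] {k : ℕ} (c : HostAPI.Carriers.AlgebraicTopology.SingularHomology.singularCohomology ℂ ℂ Y k) :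
    Prop :=
  ∃ z : HostAPI.Carriers.AlgebraicTopology.SingularHomology.singularCochainComplex.cocycles ℂ ℂ Y k, HostAPI.Carriers.AlgebraicTopology.SingularHomology.singularCohomology.π ℂ ℂ Y k z = c ∧
    ∀ σ : HostAPI.Carriers.AlgebraicTopology.SingularHomology.SingularSimplex Y k,
      (HostAPI.Carriers.AlgebraicTopology.SingularHomology.singularCochainComplex.iCocycles ℂ ℂ Y k z) σ ∈ Set.range (algebraMap ℚ ℂ)

theorem IsRationalClass.zero {Y : Type u} [TopologicalSpace Y] {k : ℕ} :
    IsRationalClass (0 : HostAPI.Carriers.AlgebraicTopology.SingularHomology.singularCohomology ℂ ℂ Y k) :=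
  ⟨0, map_zero _, fun σ ↦ ⟨0, by
    have h : HostAPI.Carriers.AlgebraicTopology.SingularHomology.singularCochainComplex.iCocycles ℂ ℂ Y k (0 : HostAPI.Carriers.AlgebraicTopology.SingularHomology.singularCochainComplex.cocycles ℂ ℂ Y k)
      = 0 := map_zero _
    rw [h, map_zero]; rfl⟩⟩

theorem IsRationalClass.add {Y : Type u} [TopologicalSpace Y] {k : ℕ}
    {c c' : HostAPI.Carriers.AlgebraicTopology.SingularHomology.singularCohomology ℂ ℂ Y k} (hc : IsRationalClass c) (hc' : IsRationalClass c') :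
    IsRationalClass (c + c') := by
  obtain ⟨z, rfl, hz⟩ := hc
  obtain ⟨z', rfl, hz'⟩ := hc'
  refine ⟨z + z', map_add _ _ _, fun σ ↦ ?_⟩
  obtain ⟨a, ha⟩ := hz σ
  obtain ⟨a', ha'⟩ := hz' σ
  exact ⟨a + a', by rw [map_add, map_add, ha, ha']; rfl⟩

theorem IsRationalClass.smul {Y : Type u} [TopologicalSpace Y] {k : ℕ}
    {c : HostAPI.Carriers.AlgebraicTopology.SingularHomology.singularCohomology ℂ ℂ Y k} (hc : IsRationalClass c) (a : ℚ) :
    IsRationalClass ((a : ℂ) • c) := by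
  obtain ⟨z, rfl, hz⟩ := hc
  refine ⟨(a : ℂ) • z, map_smul _ _ _, fun σ ↦ ?_⟩
  obtain ⟨b, hb⟩ := hz σ
  exact ⟨a * b, by rw [map_mul, map_smul, hb]; rfl⟩

theorem IsRationalClass.pullback {Y Y' : Type u} [TopologicalSpace Y] [TopologicalSpace Y']
    (f : C(Y', Y)) {k : ℕ} {c : HostAPI.Carriers.AlgebraicTopology.SingularHomology.singularCohomology ℂ ℂ Y k}
    (hc : IsRationalClass c) :
    IsRationalClass (HostAPI.Carriers.AlgebraicTopology.SingularHomology.singularCohomology.map ℂ ℂ f k c) := by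
  obtain ⟨z, rfl, hz⟩ := hc
  refine ⟨HostAPI.Carriers.AlgebraicTopology.SingularHomology.singularCochainComplex.cocyclesMap ℂ ℂ f k z,
    (HostAPI.Carriers.AlgebraicTopology.SingularHomology.singularCohomology.map_π f z).symm, fun σ ↦ ?_⟩
  rw [HostAPI.Carriers.AlgebraicTopology.SingularHomology.singularCochainComplex.iCocycles_cocyclesMap,
    HostAPI.Carriers.AlgebraicTopology.SingularHomology.singularCochainComplex.map_apply]
  exact hz _

structure HodgeModel (n : ℕ) (X : Motives.SchemeOver ℂ) : Type 1 where

  model : Type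

  [normedAddCommGroup : NormedAddCommGroup model]

  [normedSpace : NormedSpace ℂ model]

  [finiteDimensional : FiniteDimensional ℂ model]

  carrier : Type

  [topologicalSpace : TopologicalSpace carrier]

  [chartedSpace : ChartedSpace model carrier]

  [isManifold : IsManifold 𝓘(ℂ, model) ω carrier]

  [isManifold_real : IsManifold 𝓘(ℝ, model) ∞ carrier]

  [t2Space : T2Space carrier]

  [sigmaCompactSpace : SigmaCompactSpace carrier]

  toComplexPoints : carrier → Motives.ComplexPoints X

  isAnalytification : HostAPI.Carriers.NumberTheory.Transcendental.IsAnalytification model X n toComplexPoints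

  deRham : HostAPI.Carriers.NumberTheory.Transcendental.ComplexDeRhamIsoFamily model

  deRham_isNatural : deRham.IsNatural

  isInternal_hodgePQ : ∀ k : ℕ,
    DirectSum.IsInternal fun pq : ↥(Finset.antidiagonal k) ↦ HostAPI.Carriers.NumberTheory.Transcendental.hodgePQ model carrier k pq.1.1 pq.1.2

namespace HodgeModel

attribute [instance] normedAddCommGroup normedSpace finiteDimensional topologicalSpace chartedSpace
  isManifold isManifold_real t2Space sigmaCompactSpace

variable {n : ℕ} {X : Motives.SchemeOver ℂ} (A : HodgeModel n X)

abbrev pullback (k : ℕ) :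
    HostAPI.Carriers.AlgebraicTopology.SingularHomology.singularCohomology ℂ ℂ (Motives.ComplexPoints X) k ⟶ HostAPI.Carriers.AlgebraicTopology.SingularHomology.singularCohomology ℂ ℂ A.carrier k :=
  HostAPI.Carriers.AlgebraicTopology.SingularHomology.singularCohomology.map ℂ ℂ ⟨A.toComplexPoints, A.isAnalytification.isHomeomorph.continuous⟩ k

def hodgePQ (k p q : ℕ) : Submodule ℂ (HostAPI.Carriers.AlgebraicTopology.SingularHomology.singularCohomology ℂ ℂ A.carrier k) :=
  (HostAPI.Carriers.NumberTheory.Transcendental.hodgePQ A.model A.carrier k p q).map (A.deRham A.carrier k).toLinearMap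

end HodgeModel

def IsOfHodgeType (n : ℕ) (X : Motives.SchemeOver ℂ) (k p q : ℕ)
    (c : HostAPI.Carriers.AlgebraicTopology.SingularHomology.singularCohomology ℂ ℂ (Motives.ComplexPoints X) k) : Prop :=
  ∃ A : HodgeModel n X, A.pullback k c ∈ A.hodgePQ k p q

theorem IsOfHodgeType.zero {n : ℕ} {X : Motives.SchemeOver ℂ} (A : HodgeModel n X) (k p q : ℕ) :
    IsOfHodgeType n X k p q 0 :=
  ⟨A, by rw [map_zero]; exact Submodule.zero_mem _⟩

end HodgeTheory

end HostAPI.Carriers.AlgebraicGeometry.HodgeTheory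

end
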